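import Literature.Probability.LatticeModels.CriticalUrsellFourSign
import Literature.Probability.LatticeModels.PointwiseScalingLimitTwoPointMono
import Literature.Probability.LatticeModels.GKSInequalities
import Literature.Probability.LatticeModels.HighDimTrivialityWick
import HarnessLib

/-!
# The GKS floor of the critical Ursell function and the "pinned sandwich" for pointwise limits

Topic `Probability/LatticeModels`; family `crit-ising`. THEOREM-ONLY leaf file (no definitions, no
named facts). For the nearest-neighbour Ising model on `ℤ^d`:

* `criticalCorr_two_mul_two_le_four` (`d ≥ 3`) — GKS II for the critical state at DISTINCT points:
  `⟨σ_{y₀}σ_{y₁}⟩_{β_c}⟨σ_{y₂}σ_{y₃}⟩_{β_c} ≤ ⟨σ_{y₀}σ_{y₁}σ_{y₂}σ_{y₃}⟩_{β_c}` (box limit, free b.c., of the tree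
  theorem `GKSInequalities.gks_two_holds`), i.e. `U₄(y) ≥ -(⟨σ_{y₀}σ_{y₂}⟩⟨σ_{y₁}σ_{y₃}⟩ + ⟨σ_{y₀}σ_{y₃}⟩⟨σ_{y₁}σ_{y₂}⟩)`.
* `eventually_injective_latticeApprox` (`d ≥ 1`) — the lattice approximation `[x/δ]` of a
  non-coincident configuration is injective for all small `δ`.
* `HasPointwiseScalingLimit.two_mul_two_le_four`, `HasPointwiseScalingLimit.limitConnectedFour_sandwich`
  (`d ≥ 3`, any renormalisation) — in the limit: `S₂(x₀,x₁)S₂(x₂,x₃) ≤ S₄(x)` and, with Lebowitz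
  (`limitConnectedFour_nonpos_of_hasPointwiseScalingLimit`), the PINNED SANDWICH
  `-(S₂(x₀,x₂)S₂(x₁,x₃) + S₂(x₀,x₃)S₂(x₁,x₂)) ≤ U₄^S(x) ≤ 0` on non-coincident quadruples: the ratio
  `V := U₄^S / cross ∈ [-1, 0]`, and the limit is Gaussian at order four iff `V ≡ 0`.

## References

* S. Friedli, Y. Velenik, *Statistical Mechanics of Lattice Systems* (2017), Thm. 3.20 (GKS)
  [FriedliVelenik2017].
* J. L. Lebowitz, Comm. Math. Phys. 35 (1974) 87–92 [Lebowitz1974].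
-/

noncomputable section

namespace Literature.Probability.LatticeModels

open Filter Finset
open scoped _root_.Topology symmDiff

variable {d : ℕ}

/-- Spin monomial of an injective tuple = spin product of its image (cf.
`spinMonomial_eq_spinProduct_image` of `PlanarIsingMultiPointLimits`, not imported here). [folklore] -/
theorem spinMonomial_eq_spinProduct_image' {n : ℕ} {y : Fin n → Site d}
    (hy : Function.Injective y) : spinMonomial y = spinProduct (Finset.univ.image y) := by
  funext s
  unfold spinMonomial spinProduct
  rw [Finset.prod_image fun i _ j _ h => hy h]

/-- The image of an injective pair. [folklore] -/
theorem image_pair_eq {a b : Site d} :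
    (Finset.univ.image ![a, b] : Finset (Site d)) = {a, b} := by
  ext v
  simp only [Finset.mem_image, Finset.mem_univ, true_and, Fin.exists_fin_two, Matrix.cons_val_zero,
    Matrix.cons_val_one, Finset.mem_insert, Finset.mem_singleton]
  constructor
  · rintro (h | h); exacts [Or.inl h.symm, Or.inr h.symm]
  · rintro (h | h); exacts [Or.inl h.symm, Or.inr h.symm]

/-- **GKS II for the critical state at distinct points** (`d ≥ 3`):
`⟨σ_{y₀}σ_{y₁}⟩_{β_c}⟨σ_{y₂}σ_{y₃}⟩_{β_c} ≤ ⟨∏σ_{yᵢ}⟩_{β_c}`. [cite: FriedliVelenik2017, Thm. 3.20, eq. (3.22), p. 109] -/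
theorem criticalCorr_two_mul_two_le_four (hd : 3 ≤ d) {y : Fin 4 → Site d} (hy : Function.Injective y) :
    criticalCorr d 2 ![y 0, y 1] * criticalCorr d 2 ![y 2, y 3] ≤ criticalCorr d 4 y := by
  classical
  have hmem : (BoundaryCondition.free : BoundaryCondition (Site d)) ∈
      ({.free, .plus, .minus} : Set (BoundaryCondition (Site d))) := by simp
  have h4 : Tendsto (fun L : ℕ => isingExpect (zdGraph d) (box d L) (criticalBeta d) 0 .free (spinMonomial y))
      atTop (𝓝 (criticalCorr d 4 y)) := criticalCorr_wellDefined_holds (d := d) hd 4 y .free hmem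
  have h01 : Tendsto (fun L : ℕ => isingExpect (zdGraph d) (box d L) (criticalBeta d) 0 .free
      (spinMonomial ![y 0, y 1])) atTop (𝓝 (criticalCorr d 2 ![y 0, y 1])) :=
    criticalCorr_wellDefined_holds (d := d) hd 2 _ .free hmem
  have h23 : Tendsto (fun L : ℕ => isingExpect (zdGraph d) (box d L) (criticalBeta d) 0 .free
      (spinMonomial ![y 2, y 3])) atTop (𝓝 (criticalCorr d 2 ![y 2, y 3])) :=
    criticalCorr_wellDefined_holds (d := d) hd 2 _ .free hmem
  refine le_of_tendsto_of_tendsto (h01.mul h23) h4 ?_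
  filter_upwards [eventually_forall_mem_box y] with L hL
  have hinj01 : Function.Injective (![y 0, y 1] : Fin 2 → Site d) := by
    intro i j h; fin_cases i <;> fin_cases j
    · rfl
    · exact absurd (hy h) (by decide)
    · exact absurd (hy h) (by decide)
    · rfl
  have hinj23 : Function.Injective (![y 2, y 3] : Fin 2 → Site d) := by
    intro i j h; fin_cases i <;> fin_cases j
    · rfl
    · exact absurd (hy h) (by decide)
    · exact absurd (hy h) (by decide)
    · rfl
  have hAB : ({y 0, y 1} : Finset (Site d)) ∆ {y 2, y 3} = Finset.univ.image y := by
    ext v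
    simp only [Finset.mem_symmDiff, Finset.mem_insert, Finset.mem_singleton, Finset.mem_image,
      Finset.mem_univ, true_and]
    have h02 : y 0 ≠ y 2 := fun h => absurd (hy h) (by decide)
    have h03 : y 0 ≠ y 3 := fun h => absurd (hy h) (by decide)
    have h12 : y 1 ≠ y 2 := fun h => absurd (hy h) (by decide)
    have h13 : y 1 ≠ y 3 := fun h => absurd (hy h) (by decide)
    constructor
    · rintro (⟨h | h, -⟩ | ⟨h | h, -⟩)
      · exact ⟨0, h.symm⟩
      · exact ⟨1, h.symm⟩
      · exact ⟨2, h.symm⟩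
      · exact ⟨3, h.symm⟩
    · rintro ⟨i, rfl⟩
      fin_cases i
      · exact Or.inl ⟨Or.inl rfl, fun h => h.elim (fun h => h02 h) (fun h => h03 h)⟩
      · exact Or.inl ⟨Or.inr rfl, fun h => h.elim (fun h => h12 h) (fun h => h13 h)⟩
      · exact Or.inr ⟨Or.inl rfl, fun h => h.elim (fun h => h02 h.symm) (fun h => h12 h.symm)⟩
      · exact Or.inr ⟨Or.inr rfl, fun h => h.elim (fun h => h03 h.symm) (fun h => h13 h.symm)⟩
  have e4 : isingExpect (zdGraph d) (box d L) (criticalBeta d) 0 .free (spinMonomial y) =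
      isingCorr (zdGraph d) (box d L) (criticalBeta d) 0 .free (({y 0, y 1} : Finset (Site d)) ∆ {y 2, y 3}) := by
    rw [isingCorr, hAB, spinMonomial_eq_spinProduct_image' hy]
  have e01 : isingExpect (zdGraph d) (box d L) (criticalBeta d) 0 .free (spinMonomial ![y 0, y 1]) =
      isingCorr (zdGraph d) (box d L) (criticalBeta d) 0 .free {y 0, y 1} := by
    rw [isingCorr, spinMonomial_eq_spinProduct_image' hinj01, image_pair_eq]
  have e23 : isingExpect (zdGraph d) (box d L) (criticalBeta d) 0 .free (spinMonomial ![y 2, y 3]) =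
      isingCorr (zdGraph d) (box d L) (criticalBeta d) 0 .free {y 2, y 3} := by
    rw [isingCorr, spinMonomial_eq_spinProduct_image' hinj23, image_pair_eq]
  rw [e4, e01, e23]
  refine GKSInequalities.gks_two_holds (zdGraph d) (criticalBeta_nonneg d) le_rfl (Or.inl rfl) ?_ ?_
  · intro v hv
    simp only [Finset.mem_insert, Finset.mem_singleton] at hv
    rcases hv with rfl | rfl
    · exact hL 0
    · exact hL 1
  · intro v hv
    simp only [Finset.mem_insert, Finset.mem_singleton] at hv
    rcases hv with rfl | rfl
    · exact hL 2
    · exact hL 3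

/-- Hence the **GKS floor of the critical Ursell function** at distinct points (`d ≥ 3`):
`U₄(y) ≥ -(⟨σ_{y₀}σ_{y₂}⟩⟨σ_{y₁}σ_{y₃}⟩ + ⟨σ_{y₀}σ_{y₃}⟩⟨σ_{y₁}σ_{y₂}⟩)`. [cite: FriedliVelenik2017, Thm. 3.20] -/
theorem criticalUrsellFour_ge_neg_cross (hd : 3 ≤ d) {y : Fin 4 → Site d} (hy : Function.Injective y) :
    -(criticalCorr d 2 ![y 0, y 2] * criticalCorr d 2 ![y 1, y 3]
        + criticalCorr d 2 ![y 0, y 3] * criticalCorr d 2 ![y 1, y 2]) ≤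
      criticalCorr d 4 y - (criticalCorr d 2 ![y 0, y 1] * criticalCorr d 2 ![y 2, y 3]
        + criticalCorr d 2 ![y 0, y 2] * criticalCorr d 2 ![y 1, y 3]
        + criticalCorr d 2 ![y 0, y 3] * criticalCorr d 2 ![y 1, y 2]) := by
  have h := criticalCorr_two_mul_two_le_four hd hy
  linarith

/-- **The lattice approximation of a non-coincident configuration is eventually injective**
(`d ≥ 1`): `[xᵢ/δ] ≠ [xⱼ/δ]` for `δ < ‖xᵢ - xⱼ‖_∞/3`. [folklore] -/
theorem eventually_injective_latticeApprox (hd : 1 ≤ d) {n : ℕ} {x : Fin n → EuclideanSpace ℝ (Fin d)}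
    (hx : x ∈ NonCoincident d n) :
    ∀ᶠ δ in 𝓝[>] (0:ℝ), Function.Injective fun i => latticeApprox δ (x i) := by
  have hinj : Function.Injective x := hx
  have hpair : ∀ i j : Fin n, i ≠ j → ∀ᶠ δ in 𝓝[>] (0:ℝ), latticeApprox δ (x i) ≠ latticeApprox δ (x j) := by
    intro i j hij
    have hr : 0 < ‖WithLp.ofLp (x i) - WithLp.ofLp (x j)‖ := by
      rw [norm_pos_iff, sub_ne_zero]
      exact fun h => hij (hinj ((WithLp.ofLp_injective 2) h))
    have hm : Set.Ioo (0:ℝ) (‖WithLp.ofLp (x i) - WithLp.ofLp (x j)‖ / 3) ∈ 𝓝[>] (0:ℝ) :=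
      Ioo_mem_nhdsGT (by positivity)
    filter_upwards [hm] with δ hδ heq
    have h := le_supNorm_latticeApprox_sub hd hδ.1 (x i) (x j)
    rw [heq, sub_self] at h
    have h0 : (Site.supNorm (0 : Site d) : ℝ) = 0 := by
      rw [← Site.norm_eq_supNorm]; simp
    rw [h0] at h
    have := hδ.2
    rw [lt_div_iff₀ (by norm_num : (0:ℝ) < 3)] at this
    rw [sub_nonpos, div_le_iff₀ hδ.1] at h
    linarith
  have hall : ∀ᶠ δ in 𝓝[>] (0:ℝ), ∀ i j : Fin n,
      latticeApprox δ (x i) = latticeApprox δ (x j) → i = j := by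
    refine Filter.eventually_all.2 fun i => Filter.eventually_all.2 fun j => ?_
    by_cases hij : i = j
    · exact Filter.Eventually.of_forall fun δ _ => hij
    · exact (hpair i j hij).mono fun δ hδ h => absurd h hδ
  exact hall.mono fun δ h => fun i j hij => h i j hij

/-- **GKS II in the limit** (`d ≥ 3`, any `ρ`): `S₂(x₀,x₁)S₂(x₂,x₃) ≤ S₄(x)` for non-coincident `x`.
[cite: FriedliVelenik2017, Thm. 3.20] -/
theorem HasPointwiseScalingLimit.two_mul_two_le_four (hd : 3 ≤ d) {ρ : ℝ → ℝ} {S : CorrFamily d}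
    (hlim : HasPointwiseScalingLimit (criticalCorr d) ρ S)
    {x : Fin 4 → EuclideanSpace ℝ (Fin d)} (hx : x ∈ NonCoincident d 4) :
    S 2 ![x 0, x 1] * S 2 ![x 2, x 3] ≤ S 4 x := by
  have hinj : Function.Injective x := hx
  have hpair : ∀ i j, i ≠ j → Tendsto
      (fun δ => ρ δ ^ 2 * criticalCorr d 2 ![latticeApprox δ (x i), latticeApprox δ (x j)])
      (𝓝[>] 0) (𝓝 (S 2 ![x i, x j])) := by
    intro i j hij
    have hmem : (![x i, x j] : Fin 2 → EuclideanSpace ℝ (Fin d)) ∈ NonCoincident d 2 :=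
      pair_mem_nonCoincident fun h => hij (hinj h)
    refine Tendsto.congr (fun δ => ?_) ((hlim 2).tendsto_at hmem)
    rw [rescaledCorrelator_apply, latticeApprox_comp_two]
    rfl
  have h4 : Tendsto (fun δ => ρ δ ^ 4 * criticalCorr d 4 (fun i => latticeApprox δ (x i))) (𝓝[>] 0)
      (𝓝 (S 4 x)) := (hlim 4).tendsto_at hx
  refine le_of_tendsto_of_tendsto ((hpair 0 1 (by decide)).mul (hpair 2 3 (by decide))) h4 ?_
  filter_upwards [eventually_injective_latticeApprox (by omega) hx] with δ hδ
  have h := criticalCorr_two_mul_two_le_four hd hδ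
  have hρ4 : (0:ℝ) ≤ ρ δ ^ 4 := by positivity
  calc ρ δ ^ 2 * criticalCorr d 2 ![latticeApprox δ (x 0), latticeApprox δ (x 1)] *
        (ρ δ ^ 2 * criticalCorr d 2 ![latticeApprox δ (x 2), latticeApprox δ (x 3)])
      = ρ δ ^ 4 * (criticalCorr d 2 ![latticeApprox δ (x 0), latticeApprox δ (x 1)] *
          criticalCorr d 2 ![latticeApprox δ (x 2), latticeApprox δ (x 3)]) := by ring
    _ ≤ ρ δ ^ 4 * criticalCorr d 4 (fun i => latticeApprox δ (x i)) := mul_le_mul_of_nonneg_left h hρ4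

/-- **The pinned sandwich** for every pointwise limit of the critical correlators (`d ≥ 3`, any `ρ`):
`-(S₂(x₀,x₂)S₂(x₁,x₃) + S₂(x₀,x₃)S₂(x₁,x₂)) ≤ U₄^S(x) ≤ 0` on non-coincident quadruples. [cite: Lebowitz1974, Theorem, eq. (2.5b)] [cite: FriedliVelenik2017, Thm. 3.20] -/
theorem HasPointwiseScalingLimit.limitConnectedFour_sandwich (hd : 3 ≤ d) {ρ : ℝ → ℝ} {S : CorrFamily d}
    (hlim : HasPointwiseScalingLimit (criticalCorr d) ρ S)
    {x : Fin 4 → EuclideanSpace ℝ (Fin d)} (hx : x ∈ NonCoincident d 4) :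
    -(S 2 ![x 0, x 2] * S 2 ![x 1, x 3] + S 2 ![x 0, x 3] * S 2 ![x 1, x 2]) ≤ limitConnectedFour S x ∧
      limitConnectedFour S x ≤ 0 := by
  refine ⟨?_, limitConnectedFour_nonpos_of_hasPointwiseScalingLimit hd hlim hx⟩
  have h := hlim.two_mul_two_le_four hd hx
  simp only [limitConnectedFour]
  linarith

end Literature.Probability.LatticeModels

end
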